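import Summits.HodgeConjecture.HodgeConjecture.Theses.AffinePartDecay
import Summits.HodgeConjecture.HodgeConjecture.Theorems.LimitExtensionMiddleDivisorSupportSufficesProof
import Summits.HodgeConjecture.HodgeConjecture.Theorems.GenericDivisibilityHodgeClassesGenericallyDivisibleAboveDim
import Literature.AlgebraicGeometry.HodgeTheory.ComplexConjugationHolds
import Literature.AlgebraicGeometry.Motives.UnramifiedCohomology

/-!
# Route AffinePartDecay — `Assembly` (assembly item stmt-HodgeConjecture-1972)

The assembly item of route `AffinePartDecay`,

  WeakLefschetzAlgebraicClasses → AffineMiddleDegree → HodgeConjecture.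

`AffineMiddleDegree` says: on a smooth projective complex `2m`-fold `X`, for every Zariski-closed
`H ⊆ X` with affine complement, every rational middle-degree class of Hodge type `(m, m)` lies in
`algebraicClasses X m ⊔ ker (H²ᵐ(X(ℂ); ℂ) → H²ᵐ((X ∖ H)(ℂ); ℂ))`.  Choosing for `H` the complement of a
non-empty affine open (it exists and is a proper closed subset, `X` being integral), both summands lie
in `N¹ H²ᵐ(X(ℂ); ℂ) = supportedClasses X (2m) 1` (`algebraicClasses X m = Nᵐ ⊆ N¹` for `m ≥ 1`, and the
kernel is supported on the proper closed subset `H`, all of whose points have codimension `≥ 1`).  So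
`AffineMiddleDegree` gives `MiddleDivisorSupport` — every rational middle-degree Hodge class on an
even-dimensional smooth projective variety has coniveau `≥ 1` — and the tree's theorem
`limitExtension_middleDivisorSupportSuffices_proof` (dimension induction: pencil step below the
middle, divisor induction by Deligne's principle of two types at the middle, Andreotti–Frankel above;
Hodge models by `nonempty_hodgeModel_holds`) concludes the Hodge conjecture.  The first hypothesis
`WeakLefschetzAlgebraicClasses` is NOT used: below the middle degree the tree's unconditional pencil
step already serves.  No named-fact hypothesis, no sorry.
-/

-- `Summit.HodgeConjecture.HodgeConjecture.Theorems` is the mandated namespace (single-problem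
-- summit: Problem = Summit), which `linter.dupNamespace` flags on every declaration; the lakefile
-- turns the linter off tree-wide (weak option), restated here so stand-alone elaboration is
-- warning-free too.
set_option linter.dupNamespace false

noncomputable section

namespace Summit.HodgeConjecture.HodgeConjecture.Theorems

open AlgebraicGeometry Literature.AlgebraicGeometry.Motives Literature.AlgebraicGeometry.HodgeTheory
  Literature.AlgebraicTopology.SingularHomology

/-- **`AffineMiddleDegree` gives divisor support of middle-degree Hodge classes** (route
`AffinePartDecay`): if on every smooth projective complex `2m`-fold every rational `(m, m)`-class lies in
`algebraicClasses X m ⊔ ker (restriction to the complement of H)` for every closed `H` with affine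
complement, then every rational middle-degree `(p, p)`-class (`p ≥ 1`) on a smooth projective `2p`-fold
has coniveau `≥ 1` (`LimitExtension.MiddleDivisorSupport`): take `H` the complement of a non-empty
affine open; `algebraicClasses X p = Nᵖ ⊆ N¹` and the kernel is supported on the proper closed `H`.
[cite: GrothendieckTopology1969, §1] -/
theorem affinePartDecay_middleDivisorSupport_of_affineMiddleDegree
    (hAff : Summit.HodgeConjecture.HodgeConjecture.Theses.AffinePartDecay.AffineMiddleDegree) :
    Summit.HodgeConjecture.HodgeConjecture.Theses.LimitExtension.MiddleDivisorSupport := by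
  intro p X hp hX c hc hpp
  obtain ⟨U, hU, hH, hne⟩ := genericDivisibility_exists_isAffineOpen_compl_ne_univ hX
  have hUo : IsAffineOpen (⟨((U : Set X.left)ᶜ)ᶜ, hH.isOpen_compl⟩ : X.left.Opens) := by
    have hUeq : (⟨((U : Set X.left)ᶜ)ᶜ, hH.isOpen_compl⟩ : X.left.Opens) = U :=
      TopologicalSpace.Opens.ext (compl_compl _)
    rw [hUeq]
    exact hU
  obtain ⟨y, hy, z, hz, rfl⟩ := Submodule.mem_sup.1 (hAff hX ((U : Set X.left)ᶜ) hH hUo c hc hpp)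
  haveI : IsIntegral X.left := IsSmoothProjective.isIntegral_holds hX
  refine add_mem (supportedClasses_mono X (2 * p) hp hy) ?_
  exact mem_supportedClasses_of_restrictCompl_eq_zero hH
    ((forall_one_le_coheight_iff_ne_univ hH).2 hne) (LinearMap.mem_ker.1 hz)

/-- **Item stmt-HodgeConjecture-1972 (`Assembly`), route `AffinePartDecay`**:
`WeakLefschetzAlgebraicClasses → AffineMiddleDegree → HodgeConjecture`.  `AffineMiddleDegree` gives
`MiddleDivisorSupport` (`affinePartDecay_middleDivisorSupport_of_affineMiddleDegree`), and
`MiddleDivisorSupport` implies the Hodge conjecture by the tree's dimension induction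
`limitExtension_middleDivisorSupportSuffices_proof` with Hodge models `nonempty_hodgeModel_holds`;
the weak-Lefschetz hypothesis is idle.  The type is the route decl
`Summit.HodgeConjecture.HodgeConjecture.Theses.AffinePartDecay.Assembly`.
[cite: Thomas2005Nodes, §2 Prop. 2] [cite: DeligneHodgeIII1974, Prop. 8.2.7 and Cor. 8.2.8] -/
theorem affinePartDecay_assembly_proof :
    Summit.HodgeConjecture.HodgeConjecture.Theses.AffinePartDecay.Assembly :=
  fun _hWL hAff ↦ limitExtension_middleDivisorSupportSuffices_proof
    (fun _ _ hX ↦ nonempty_hodgeModel_holds hX)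
    (affinePartDecay_middleDivisorSupport_of_affineMiddleDegree hAff)

end Summit.HodgeConjecture.HodgeConjecture.Theorems

end
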